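import Mathlib
import Literature.Analysis.Matrix.QuadraticCombesThomas
import HarnessLib

/-!
# Weighted coercivity of `AᴴA + μ` below a LOCAL floor (Combes–Thomas/Agmon conjugation)

Topic `Literature/Analysis/Matrix`; namespace `Literature.Analysis.Matrix`.  Everything here is
PROVED (no definitions, no named facts).  Companion of `QuadraticCombesThomas` (the point-weight,
global-floor case); consumed by `AgmonDecayBelowLocalFloor` (decay of sub-threshold
eigenvectors).

Setting.  `ι` is a finite index set with an `ℕ`-valued `dist`, `A : Matrix ι ι ℂ` has RANGE ONE
(`A i j ≠ 0 → dist i j ≤ 1`) and absolute row and column sums over `{j | dist i j ≠ 0}` at most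
`h`; `η := h(e^θ − 1)` for a rate `θ ≥ 0`.

* `weighted_coercive_of_localFloor` — the Combes–Thomas/Agmon weighted coercivity with a GENERAL
  `1`-Lipschitz exponent `ρ : ι → ℝ` (`|ρ i − ρ j| ≤ dist i j`) and a LOCAL floor: if
  `F Σ|w|² ≤ Σ|Aw|²` for every `w` supported in a set `good`, and `t² − 2ηt − η² + μ ≥ γ` for
  `t ≥ √F`, then for every `x` supported in `good`,
  `γ Σ_k e^{2θρ_k}|x_k|² ≤ Re Σ_k e^{2θρ_k} conj(x_k) ((AᴴA + μ)x)_k`.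
* `weighted_sum_sq_le_of_localFloor` — the `ℓ²` consequence (Cauchy–Schwarz):
  `γ² Σ_k e^{2θρ_k}|x_k|² ≤ Σ_k e^{2θρ_k}|((AᴴA + μ)x)_k|²` (`γ ≥ 0`).

Proof ([CombesThomas1973]; [AizenmanWarzel2015, §10.3], sandwich form, exactly as in
`quadraticCombesThomas_weighted_coercive` with `dist(·, j₀)` replaced by `ρ`): with
`W = diag(e^{θρ})`, `W(AᴴA + μ)W⁻¹ = (A + E₋)ᴴ(A + E₊) + μ`,
`(E_±)_{lk} = A_{lk}(e^{±θ(ρ_l − ρ_k)} − 1)`, `|ρ_l − ρ_k| ≤ dist(l,k) ≤ 1` on the support of `A`,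
Schur's test gives `‖E_±‖ ≤ η`, and the floor is only ever applied to `W x`, which has the support
of `x`.

References: Combes–Thomas, Comm. Math. Phys. 34 (1973) 251 [CombesThomas1973]; Aizenman–Warzel,
GSM 168, §10.3 [AizenmanWarzel2015].  Not here: the eigenvector decay (see
`AgmonDecayBelowLocalFloor`), operator-norm formulations, infinite index sets.
-/

noncomputable section

open Finset
open scoped Matrix ComplexConjugate

namespace Literature.Analysis.Matrix

section LocalAgmon

variable {ι : Type*} [Fintype ι] [DecidableEq ι]

/-- **Weighted coercivity of `AᴴA + μ` below a local floor** (the Combes–Thomas/Agmon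
conjugation with a general `1`-Lipschitz exponent `ρ`, unfolded).  Let `A` have range one for
`dist` with off-site absolute row and column sums `≤ h`, let `|ρ i − ρ j| ≤ dist i j`, let the
floor `F Σ|w_i|² ≤ Σ|(Aw)_i|²` hold for every `w` supported in `good`, and let
`t² − 2ηt − η² + μ ≥ γ` for all `t ≥ √F`, `η = h(e^θ − 1)`, `θ ≥ 0`.  Then for every `x` supported
in `good`, with the weights `d_k = e^{θρ_k}`:
`γ Σ_k d_k²|x_k|² ≤ Re Σ_k d_k² conj(x_k) ((AᴴA + μ)x)_k`.
(With `v = d·x`: the right side is `Re⟨(A + E₋)v, (A + E₊)v⟩ + μ‖v‖²` with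
`(E_±)_{lk} = A_{lk}(e^{±θ(ρ_l − ρ_k)} − 1)`, `‖E_±‖ ≤ η` by Schur's test, and `v` is supported in
`good`, so the floor applies to `‖Av‖`.) [folklore] -/
theorem weighted_coercive_of_localFloor (dist : ι → ι → ℕ)
    (A : Matrix ι ι ℂ) (hrange : ∀ i j, A i j ≠ 0 → dist i j ≤ 1) (h : ℝ)
    (hrow : ∀ i, ∑ j ∈ univ.filter (fun j => dist i j ≠ 0), ‖A i j‖ ≤ h)
    (hcol : ∀ j, ∑ i ∈ univ.filter (fun i => dist i j ≠ 0), ‖A i j‖ ≤ h)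
    (ρ : ι → ℝ) (hρ : ∀ i j, |ρ i - ρ j| ≤ dist i j) (good : ι → Prop)
    (F μ θ γ : ℝ) (hθ : 0 ≤ θ)
    (hfloor : ∀ w : ι → ℂ, (∀ i, w i ≠ 0 → good i) →
      F * ∑ i, ‖w i‖ ^ 2 ≤ ∑ i, ‖(A *ᵥ w) i‖ ^ 2)
    (hcoer : ∀ t : ℝ, Real.sqrt F ≤ t →
      γ ≤ t ^ 2 - 2 * (h * (Real.exp θ - 1)) * t - (h * (Real.exp θ - 1)) ^ 2 + μ)
    (x : ι → ℂ) (hx : ∀ i, x i ≠ 0 → good i) :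
    γ * ∑ k, Real.exp (θ * ρ k) ^ 2 * ‖x k‖ ^ 2 ≤
      (star (fun k => ((Real.exp (θ * ρ k) ^ 2 : ℝ) : ℂ) * x k) ⬝ᵥ
        ((Aᴴ * A + (μ : ℂ) • (1 : Matrix ι ι ℂ)) *ᵥ x)).re := by
  rcases isEmpty_or_nonempty ι with hι | ⟨⟨j₀⟩⟩
  · simp [dotProduct]
  -- the weights, the weighted vectors and the perturbations
  set η : ℝ := h * (Real.exp θ - 1) with hη
  set d : ι → ℝ := fun k => Real.exp (θ * ρ k) with hd
  set v : ι → ℂ := fun k => (d k : ℂ) * x k with hv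
  set y : ι → ℂ := fun k => ((d k ^ 2 : ℝ) : ℂ) * x k with hy
  set Ep : Matrix ι ι ℂ := Matrix.of fun l k =>
    A l k * ((Real.exp (θ * (ρ l - ρ k)) - 1 : ℝ) : ℂ) with hEp
  set Em : Matrix ι ι ℂ := Matrix.of fun l k =>
    A l k * ((Real.exp (θ * (ρ k - ρ l)) - 1 : ℝ) : ℂ) with hEm
  set a : ι → ℂ := A *ᵥ v with ha
  set ep : ι → ℂ := Ep *ᵥ v with hep
  set em : ι → ℂ := Em *ᵥ v with hem
  set S : ℝ := ∑ k, ‖v k‖ ^ 2 with hS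
  have hexp0 : 0 ≤ Real.exp θ - 1 := by linarith [Real.add_one_le_exp θ]
  have hh0 : 0 ≤ h := (Finset.sum_nonneg fun j _ => norm_nonneg _).trans (hrow j₀)
  have hη0 : 0 ≤ η := mul_nonneg hh0 hexp0
  have hS0 : 0 ≤ S := Finset.sum_nonneg fun k _ => by positivity
  -- `v` is supported in `good`, so the floor applies to it
  have hvgood : ∀ i, v i ≠ 0 → good i := by
    intro i hi
    refine hx i fun hxi => hi ?_
    simp [hv, hxi]
  -- `S = Σ d_k² |x_k|²`
  have hSx : S = ∑ k, Real.exp (θ * ρ k) ^ 2 * ‖x k‖ ^ 2 := by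
    refine Finset.sum_congr rfl fun k _ => ?_
    rw [hv]
    dsimp only
    rw [norm_mul, Complex.norm_real, Real.norm_eq_abs, abs_of_pos (Real.exp_pos _), mul_pow]
  -- (1) the algebra: `y⋆ · (K x) = (a + em)⋆ · (a + ep) + μ S`
  have hpl : ∀ l, (a + ep) l = (d l : ℂ) * (A *ᵥ x) l := by
    intro l
    simp only [ha, hep, hEp, hv, Pi.add_apply, Matrix.mulVec, dotProduct, Matrix.of_apply]
    rw [← Finset.sum_add_distrib, Finset.mul_sum]
    refine Finset.sum_congr rfl fun k _ => ?_
    have hc : Real.exp (θ * (ρ l - ρ k)) * d k = d l := by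
      simp only [hd]; rw [← Real.exp_add]; ring_nf
    have hc' : ((Real.exp (θ * (ρ l - ρ k)) : ℝ) : ℂ) * (d k : ℂ) = (d l : ℂ) := by
      exact_mod_cast hc
    simp only [Complex.ofReal_sub, Complex.ofReal_one]
    linear_combination (A l k * x k) * hc'
  have hml : ∀ l, (d l : ℂ) * (a + em) l = (A *ᵥ y) l := by
    intro l
    simp only [ha, hem, hEm, hv, hy, Pi.add_apply, Matrix.mulVec, dotProduct, Matrix.of_apply]
    rw [← Finset.sum_add_distrib, Finset.mul_sum]
    refine Finset.sum_congr rfl fun k _ => ?_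
    have hc : Real.exp (θ * (ρ k - ρ l)) * d l = d k := by
      simp only [hd]; rw [← Real.exp_add]; ring_nf
    have hc' : ((Real.exp (θ * (ρ k - ρ l)) : ℝ) : ℂ) * (d l : ℂ) = (d k : ℂ) := by
      exact_mod_cast hc
    simp only [Complex.ofReal_sub, Complex.ofReal_one, Complex.ofReal_pow]
    linear_combination (A l k * x k * d k) * hc'
  have hAyAx : star (A *ᵥ y) ⬝ᵥ (A *ᵥ x) = star (a + em) ⬝ᵥ (a + ep) := by
    simp only [dotProduct, Pi.star_apply]
    refine Finset.sum_congr rfl fun l _ => ?_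
    rw [← hml l, hpl l, star_mul', Complex.star_def, Complex.conj_ofReal]
    ring
  have hyx : star y ⬝ᵥ x = (S : ℂ) := by
    rw [hS, Complex.ofReal_sum]
    simp only [dotProduct, Pi.star_apply, hy, hv, star_mul', Complex.star_def,
      Complex.conj_ofReal]
    refine Finset.sum_congr rfl fun k _ => ?_
    rw [norm_mul, mul_pow, Complex.norm_real, Real.norm_eq_abs, sq_abs]
    push_cast
    rw [← Complex.conj_mul']
    ring
  have hK : star y ⬝ᵥ ((Aᴴ * A + (μ : ℂ) • (1 : Matrix ι ι ℂ)) *ᵥ x) =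
      star (a + em) ⬝ᵥ (a + ep) + (μ : ℂ) * S := by
    rw [Matrix.add_mulVec, Matrix.smul_mulVec, Matrix.one_mulVec, ← Matrix.mulVec_mulVec,
      dotProduct_add, dotProduct_smul, smul_eq_mul, hyx, Matrix.dotProduct_mulVec,
      ← Matrix.star_mulVec, hAyAx]
  -- (2) the perturbations are `η`-small (Schur's test)
  have hEp_le : ∀ l k, ‖Ep l k‖ ≤ (Real.exp θ - 1) * (if dist l k ≠ 0 then ‖A l k‖ else 0) := by
    intro l k
    simp only [hEp, Matrix.of_apply]
    exact norm_mul_exp_sub_one_le dist A hrange hθ l k (hρ l k)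
  have hEm_le : ∀ l k, ‖Em l k‖ ≤ (Real.exp θ - 1) * (if dist l k ≠ 0 then ‖A l k‖ else 0) := by
    intro l k
    simp only [hEm, Matrix.of_apply]
    refine norm_mul_exp_sub_one_le dist A hrange hθ l k ?_
    rw [abs_sub_comm]
    exact hρ l k
  have hsum : ∀ (f g : ι → ℝ) (nz : ι → Prop) [DecidablePred nz],
      (∀ k, f k ≤ (Real.exp θ - 1) * (if nz k then g k else 0)) →
        ∑ k ∈ univ.filter nz, g k ≤ h → ∑ k, f k ≤ η := by
    intro f g nz _ hf hb
    calc ∑ k, f k ≤ ∑ k, (Real.exp θ - 1) * (if nz k then g k else 0) := sum_le_sum fun k _ => hf k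
      _ = (Real.exp θ - 1) * ∑ k ∈ univ.filter nz, g k := by rw [← mul_sum, sum_filter]
      _ ≤ η := by rw [hη, mul_comm h]; exact mul_le_mul_of_nonneg_left hb hexp0
  have hSchur : ∀ E : Matrix ι ι ℂ,
      (∀ l k, ‖E l k‖ ≤ (Real.exp θ - 1) * (if dist l k ≠ 0 then ‖A l k‖ else 0)) →
        ∑ l, ‖(E *ᵥ v) l‖ ^ 2 ≤ η ^ 2 * S := fun E hE => by
    simpa only [← pow_two] using sum_norm_sq_mulVec_le_of_rowSum_le_of_colSum_le E hη0
      (fun l => hsum _ _ _ (fun k => hE l k) (hrow l))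
      (fun k => hsum _ _ _ (fun l => hE l k) (hcol k)) v
  have hSp : ∑ l, ‖ep l‖ ^ 2 ≤ η ^ 2 * S := hSchur Ep hEp_le
  have hSm : ∑ l, ‖em l‖ ^ 2 ≤ η ^ 2 * S := hSchur Em hEm_le
  -- (3) the coercivity estimate
  rw [← hSx]
  have hre : (star y ⬝ᵥ ((Aᴴ * A + (μ : ℂ) • (1 : Matrix ι ι ℂ)) *ᵥ x)).re =
      (star (a + em) ⬝ᵥ (a + ep)).re + μ * S := by
    rw [hK, Complex.add_re, Complex.re_ofReal_mul, Complex.ofReal_re]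
  rw [hre]
  by_cases hS00 : S = 0
  · -- then `v = 0` and everything vanishes
    have hv0 : v = 0 := funext fun k => by
      have := (sum_eq_zero_iff_of_nonneg fun k _ => sq_nonneg ‖v k‖).mp hS00 k (mem_univ k)
      exact norm_eq_zero.mp (pow_eq_zero_iff two_ne_zero |>.mp this)
    simp [hS00, ha, hep, hem, hv0]
  have hSpos : 0 < S := lt_of_le_of_ne hS0 (Ne.symm hS00)
  -- norms
  set Na : ℝ := Real.sqrt (∑ l, ‖a l‖ ^ 2) with hNa
  set Nv : ℝ := Real.sqrt S with hNv
  set Np : ℝ := Real.sqrt (∑ l, ‖ep l‖ ^ 2) with hNp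
  set Nm : ℝ := Real.sqrt (∑ l, ‖em l‖ ^ 2) with hNm
  have hNa0 : 0 ≤ Na := Real.sqrt_nonneg _
  have hNv0 : 0 < Nv := Real.sqrt_pos.mpr hSpos
  have hNvsq : Nv ^ 2 = S := Real.sq_sqrt hS0
  have hNasq : Na ^ 2 = ∑ l, ‖a l‖ ^ 2 := Real.sq_sqrt (Finset.sum_nonneg fun l _ => by positivity)
  have hsq : Real.sqrt (η ^ 2 * S) = η * Nv := by rw [Real.sqrt_mul (sq_nonneg η), Real.sqrt_sq hη0]
  have hNp_le : Np ≤ η * Nv := hsq ▸ Real.sqrt_le_sqrt hSp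
  have hNm_le : Nm ≤ η * Nv := hsq ▸ Real.sqrt_le_sqrt hSm
  have hNp0 : 0 ≤ Np := Real.sqrt_nonneg _
  have hNm0 : 0 ≤ Nm := Real.sqrt_nonneg _
  -- the floor: `√F ≤ Na / Nv`
  have ht : Real.sqrt F ≤ Na / Nv := by
    rw [le_div_iff₀ hNv0]
    calc Real.sqrt F * Nv = Real.sqrt (F * S) := by
          rw [Real.sqrt_mul' F hS0]
      _ ≤ Na := Real.sqrt_le_sqrt (hfloor v hvgood)
  have hc2 : γ * S ≤ Na ^ 2 - 2 * η * Na * Nv - η ^ 2 * S + μ * S := by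
    have h1 : γ * Nv ^ 2 ≤ ((Na / Nv) ^ 2 - 2 * η * (Na / Nv) - η ^ 2 + μ) * Nv ^ 2 :=
      mul_le_mul_of_nonneg_right (hcoer (Na / Nv) ht) (sq_nonneg _)
    have h2 : ((Na / Nv) ^ 2 - 2 * η * (Na / Nv) - η ^ 2 + μ) * Nv ^ 2 =
        Na ^ 2 - 2 * η * Na * Nv - η ^ 2 * Nv ^ 2 + μ * Nv ^ 2 := by field_simp
    rwa [h2, hNvsq] at h1
  -- expand the sesquilinear form
  have hexpand : (star (a + em) ⬝ᵥ (a + ep)).re =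
      (star a ⬝ᵥ a).re + (star a ⬝ᵥ ep).re + (star em ⬝ᵥ a).re + (star em ⬝ᵥ ep).re := by
    rw [star_add, add_dotProduct, dotProduct_add, dotProduct_add]
    simp only [Complex.add_re]
    ring
  have haa : (star a ⬝ᵥ a).re = Na ^ 2 := by
    rw [hNasq]
    simp only [dotProduct, Pi.star_apply, Complex.re_sum, Complex.star_def, Complex.conj_mul']
    refine Finset.sum_congr rfl fun l _ => ?_
    norm_cast
  have hcs : ∀ u w : ι → ℂ, -(Real.sqrt (∑ l, ‖u l‖ ^ 2) * Real.sqrt (∑ l, ‖w l‖ ^ 2)) ≤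
      (star u ⬝ᵥ w).re := fun u w =>
    (abs_le.mp ((Complex.abs_re_le_norm _).trans (norm_star_dotProduct_le_sqrt_mul_sqrt u w))).1
  have hcs1 := hcs a ep
  have hcs2 := hcs em a
  have hcs3 := hcs em ep
  have hb1 : Na * Np ≤ η * Na * Nv := by nlinarith
  have hb2 : Nm * Na ≤ η * Na * Nv := by nlinarith
  have hb3 : Nm * Np ≤ η ^ 2 * S := by
    calc Nm * Np ≤ (η * Nv) * (η * Nv) := mul_le_mul hNm_le hNp_le hNp0 (by positivity)
      _ = η ^ 2 * S := by rw [← hNvsq]; ring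
  rw [hexpand, haa]
  linarith

/-- **Weighted `ℓ²` bound below a local floor** (Cauchy–Schwarz on
`weighted_coercive_of_localFloor`): under the same hypotheses and `γ ≥ 0`, for every `x`
supported in `good`,
`γ² Σ_k e^{2θρ_k}|x_k|² ≤ Σ_k e^{2θρ_k}|((AᴴA + μ)x)_k|²`. [folklore] -/
theorem weighted_sum_sq_le_of_localFloor (dist : ι → ι → ℕ)
    (A : Matrix ι ι ℂ) (hrange : ∀ i j, A i j ≠ 0 → dist i j ≤ 1) (h : ℝ)
    (hrow : ∀ i, ∑ j ∈ univ.filter (fun j => dist i j ≠ 0), ‖A i j‖ ≤ h)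
    (hcol : ∀ j, ∑ i ∈ univ.filter (fun i => dist i j ≠ 0), ‖A i j‖ ≤ h)
    (ρ : ι → ℝ) (hρ : ∀ i j, |ρ i - ρ j| ≤ dist i j) (good : ι → Prop)
    (F μ θ γ : ℝ) (hθ : 0 ≤ θ) (hγ : 0 ≤ γ)
    (hfloor : ∀ w : ι → ℂ, (∀ i, w i ≠ 0 → good i) →
      F * ∑ i, ‖w i‖ ^ 2 ≤ ∑ i, ‖(A *ᵥ w) i‖ ^ 2)
    (hcoer : ∀ t : ℝ, Real.sqrt F ≤ t →
      γ ≤ t ^ 2 - 2 * (h * (Real.exp θ - 1)) * t - (h * (Real.exp θ - 1)) ^ 2 + μ)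
    (x : ι → ℂ) (hx : ∀ i, x i ≠ 0 → good i) :
    γ ^ 2 * ∑ k, Real.exp (θ * ρ k) ^ 2 * ‖x k‖ ^ 2 ≤
      ∑ k, Real.exp (θ * ρ k) ^ 2 *
        ‖((Aᴴ * A + (μ : ℂ) • (1 : Matrix ι ι ℂ)) *ᵥ x) k‖ ^ 2 := by
  set g : ι → ℂ := (Aᴴ * A + (μ : ℂ) • (1 : Matrix ι ι ℂ)) *ᵥ x with hg
  set d : ι → ℝ := fun k => Real.exp (θ * ρ k) with hd
  set S : ℝ := ∑ k, Real.exp (θ * ρ k) ^ 2 * ‖x k‖ ^ 2 with hS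
  set G : ℝ := ∑ k, Real.exp (θ * ρ k) ^ 2 * ‖g k‖ ^ 2 with hG
  have h1 : γ * S ≤ (star (fun k => ((Real.exp (θ * ρ k) ^ 2 : ℝ) : ℂ) * x k) ⬝ᵥ g).re :=
    weighted_coercive_of_localFloor dist A hrange h hrow hcol ρ hρ good F μ θ γ hθ hfloor hcoer
      x hx
  -- Cauchy–Schwarz with `u = d·x`, `w = d·g`
  set u : ι → ℂ := fun k => (d k : ℂ) * x k with hu
  set w : ι → ℂ := fun k => (d k : ℂ) * g k with hw
  have huw : star (fun k => ((Real.exp (θ * ρ k) ^ 2 : ℝ) : ℂ) * x k) ⬝ᵥ g = star u ⬝ᵥ w := by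
    simp only [dotProduct, Pi.star_apply, hu, hw, hd, star_mul', Complex.star_def,
      Complex.conj_ofReal]
    refine Finset.sum_congr rfl fun k _ => ?_
    push_cast
    ring
  have hnu : ∀ (f : ι → ℂ) (k : ι), ‖(d k : ℂ) * f k‖ ^ 2 = Real.exp (θ * ρ k) ^ 2 * ‖f k‖ ^ 2 :=
    fun f k => by
    rw [norm_mul, Complex.norm_real, Real.norm_eq_abs, abs_of_pos (Real.exp_pos _), mul_pow]
  have hSu : ∑ k, ‖u k‖ ^ 2 = S := Finset.sum_congr rfl fun k _ => hnu x k
  have hGw : ∑ k, ‖w k‖ ^ 2 = G := Finset.sum_congr rfl fun k _ => hnu g k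
  have h2 : γ * S ≤ Real.sqrt S * Real.sqrt G := by
    calc γ * S ≤ _ := h1
      _ ≤ ‖star (fun k => ((Real.exp (θ * ρ k) ^ 2 : ℝ) : ℂ) * x k) ⬝ᵥ g‖ := Complex.re_le_norm _
      _ = ‖star u ⬝ᵥ w‖ := by rw [huw]
      _ ≤ Real.sqrt (∑ k, ‖u k‖ ^ 2) * Real.sqrt (∑ k, ‖w k‖ ^ 2) :=
          norm_star_dotProduct_le_sqrt_mul_sqrt u w
      _ = Real.sqrt S * Real.sqrt G := by rw [hSu, hGw]
  have hS0 : 0 ≤ S := Finset.sum_nonneg fun k _ => by positivity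
  have hG0 : 0 ≤ G := Finset.sum_nonneg fun k _ => by positivity
  by_cases hS00 : S = 0
  · rw [hS00, mul_zero]; exact hG0
  have hSpos : 0 < S := lt_of_le_of_ne hS0 (Ne.symm hS00)
  have hsqS : 0 < Real.sqrt S := Real.sqrt_pos.mpr hSpos
  -- `γ √S ≤ √G`, then square
  have h3 : γ * Real.sqrt S ≤ Real.sqrt G := by
    have h4 : γ * Real.sqrt S * Real.sqrt S ≤ Real.sqrt G * Real.sqrt S := by
      rw [mul_assoc, Real.mul_self_sqrt hS0, mul_comm (Real.sqrt G)]
      exact h2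
    exact le_of_mul_le_mul_right h4 hsqS
  have h5 : (γ * Real.sqrt S) ^ 2 ≤ Real.sqrt G ^ 2 :=
    pow_le_pow_left₀ (mul_nonneg hγ (Real.sqrt_nonneg _)) h3 2
  rw [mul_pow, Real.sq_sqrt hS0, Real.sq_sqrt hG0] at h5
  exact h5

end LocalAgmon

end Literature.Analysis.Matrix
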